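import Summits.CriticalPhenomena.PercolationContinuityZ3.Theorems.PercNearOneGluingNoHeavyLowerTailSahiStrongCubicPlus
import Mathlib.Tactic.Linarith
import Mathlib.Tactic.Ring
import HarnessLib

/-!
# `NoHeavyLowerTail` (crux stmt-CriticalPhenomena-4575), master-family line P1 (gen 16):
# the ONE-PAYER ("max-side") cubic functional `max(κ,o)·(κo − e₂) − e₃`, conjecture S₃^max ⊂ S₃⁺ ⊂ S₃, and the kernel links

Support file (seat `prim-masterthm-p1`, gen 16; `--supports stmt-CriticalPhenomena-4575`).  Three definitions
(`gladkovDefect`, `strongCubicMax`, the typed conjecture `StrongCubicMaxNonneg`), no `sorry`, standard axioms.  Memo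
`run/shared/lean/prim/prim-masterthm/FROM-prim-masterthm-p1-g16-ONE-PAYER.md` §1–§3.

SETTING (tree `SahiDeepCore`): a sandwiched triple `(A,B,N)` of up-sets (`A∖B ⊆ N`, `B∖A ⊆ N`, `N ⊆ A∪B`) has the five
cells `A∖B, B∖A, (A∩B)∖N` (the three PETALS, masses `α, β, d`), `K = A∩B∩N` (core, `κ`), `O = (A∪B)ᶜ` (outside, `o`);
`e₂ = αβ+αd+βd`, `e₃ = αβd`, and `G := κo − e₂ ≥ 0` is Gladkov's defect (`gladkov_cells`).  In these cells
`E₃(A,B,N) = (1+o)·G − e₃` (tree `sahiE_three_eq_cells`), the seat's S₃ is `G − e₃ ≥ 0`, S₃⁺ is `(κ+o)·G − e₃ ≥ 0`.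

NEW HERE (gen 16).
* `strongCubicMax := max(κ,o)·G − e₃`.  Since `0 ≤ max(κ,o) ≤ κ + o` and `G ≥ 0`, **S₃^max : `strongCubicMax ≥ 0` is STRONGER
  than S₃⁺** (`strongCubicMax_le_strongCubicPlus`), hence than S₃ and than the co-sunflower class law.  Equivalently
  (`strongCubicMax_nonneg_iff`) it is the ONE-PAYER DICHOTOMY **`e₃ ≤ o·G` ("the outside pays for all rainbows") or
  `e₃ ≤ κ·G` ("the core pays")** — the measure shadow of the comb dichotomy `T ≤ max(3S_A, 3S_B)` of the memo (§2), which
  refines CP3⁺ = `T ≤ 3S_A + 3S_B`.  On the standard 3-coordinate system `e₃ = o·G` identically in the three biases (the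
  outside pays exactly), on its dual `e₃ = κ·G`; so `max(κ,o)` is the least function `f(κ,o)` for which `e₃ ≤ f(κ,o)·G`
  can hold, and S₃^max is tight on a full-dimensional bias region of std3 (`o ≥ κ`) — unlike S₃⁺/S₃, which are tight only
  asymptotically.  CENSUS (exact integer arithmetic, product measures): every 3-cell system on ≤ 5 coordinates (all
  49 861 021 sunflower labelings of `2^5` up to petal renaming × 10 bias vectors; `2^4` × 190; `2^3` × 400 incl. arbitrary
  nonnegative exchangeable weights), 10⁴–10⁵ random / union-generated / switch / block-composite / perturbed systems on 6–7
  coordinates × 6–400 bias vectors, simulated annealing over (labeling, biases) on `2^4 … 2^7`, the OR/AND combinations of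
  std3 and its dual on disjoint supports, and the exact first-order test at all 244 one-coordinate extensions of std3:
  0 failures; maximum of `e₃ / (max(κ,o)·G)` exactly `1`, attained only at dressings of std3 / dual-std3.
* the typed conjecture `StrongCubicMaxNonneg p` and the kernel links S₃^max ⟹ S₃⁺ ⟹ S₃ ⟹ Sahi's `C₃` on every
  sandwiched increasing triple / every co-sunflower (`strongCubicPlusNonneg_of_max`, `strongCubic_nonneg_of_max`,
  `classLaw_of_max`, `coSunflower_nonneg_of_max`).
NOT claimed: the natural split "rainbows whose majority point is outside are paid by the outside" (`e₃^O ≤ o·G`) is FALSE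
(memo §1: composites of std3 on 6 coordinates, ratio 2.66); only the disjunction survives.
HONEST FRAMING: typed conjecture + reductions; S₃^max, S₃⁺, S₃ and the class law remain OPEN. [this work]
-/

noncomputable section

open scoped Classical

namespace Summit.CriticalPhenomena.PercolationContinuityZ3.Theorems

namespace SahiDeepCore

open Literature.Combinatorics.Sahi2008
open Literature.Probability.Percolation (DeterminedBy determinedBy_iff)
open Literature.Probability.Percolation.DecisionTree (ind ind_of_mem ind_of_not_mem ind_nonneg)

variable {ι : Type} [Fintype ι]

local notation3 (prettyPrint := false) "m⟦" p ", " X "⟧" => ex (bernoulliWeight p) (ind X)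

/-! ### 1. Gladkov's defect and the max-side functional -/

/-- **Gladkov's defect** `G = κ·o − (αβ + αd + βd)` of a sandwiched triple in the five cell masses; nonnegative for
up-sets by Gladkov's Theorem 2.1 (`gladkov_cells`). [cite: Gladkov2024StrongFKG, Thm. 2.1 (k = 3)] -/
def gladkovDefect (p : ι → unitInterval) (A B N : Set (Set ι)) : ℝ :=
  m⟦p, A ∩ B ∩ N⟧ * m⟦p, (A ∪ B)ᶜ⟧
    - (m⟦p, A \ B⟧ * m⟦p, B \ A⟧ + m⟦p, A \ B⟧ * m⟦p, (A ∩ B) \ N⟧ + m⟦p, B \ A⟧ * m⟦p, (A ∩ B) \ N⟧)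

/-- **The max-side ("one payer") cubic functional** `max(κ, o)·(κo − e₂) − αβd` of a sandwiched triple.  Conjecturally
nonnegative (S₃^max); it is the measure shadow of the comb dichotomy "core pays all or outside pays all" of the memo. [this work] -/
def strongCubicMax (p : ι → unitInterval) (A B N : Set (Set ι)) : ℝ :=
  max (m⟦p, A ∩ B ∩ N⟧) (m⟦p, (A ∪ B)ᶜ⟧) * gladkovDefect p A B N
    - m⟦p, A \ B⟧ * m⟦p, B \ A⟧ * m⟦p, (A ∩ B) \ N⟧

omit [Fintype ι] in
/-- Cell masses are nonnegative. [folklore] -/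
private theorem mass_nonneg [Fintype ι] (p : ι → unitInterval) (X : Set (Set ι)) : 0 ≤ m⟦p, X⟧ :=
  ex_nonneg (isFKGMeasure_bernoulliWeight p).nonneg fun ω => ind_nonneg _ ω

/-- **Gladkov's defect is nonnegative** for a sandwiched triple of up-sets. [cite: Gladkov2024StrongFKG, Thm. 2.1 (k = 3)] -/
theorem gladkovDefect_nonneg (p : ι → unitInterval) {A B N : Set (Set ι)} (hA : IsUpperSet A) (hB : IsUpperSet B)
    (hNup : IsUpperSet N) (hAB : A \ B ⊆ N) (hBA : B \ A ⊆ N) (hN : N ⊆ A ∪ B) :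
    0 ≤ gladkovDefect p A B N :=
  sub_nonneg.2 (gladkov_cells p hA hB hNup hAB hBA hN)

/-- `F_S⁺ = (κ + o)·G − e₃` (definitional unfolding of `strongCubicPlus` through the defect). [this work] -/
theorem strongCubicPlus_eq_defect (p : ι → unitInterval) (A B N : Set (Set ι)) :
    strongCubicPlus p A B N =
      (m⟦p, A ∩ B ∩ N⟧ + m⟦p, (A ∪ B)ᶜ⟧) * gladkovDefect p A B N - m⟦p, A \ B⟧ * m⟦p, B \ A⟧ * m⟦p, (A ∩ B) \ N⟧ := by
  simp only [strongCubicPlus, gladkovDefect]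

/-- **`F_S^max ≤ F_S⁺`**: `max(κ,o) ≤ κ + o` (both masses are nonnegative) and `G ≥ 0`, so the max-side conjecture is a
STRENGTHENING of S₃⁺. [this work] -/
theorem strongCubicMax_le_strongCubicPlus (p : ι → unitInterval) {A B N : Set (Set ι)} (hA : IsUpperSet A)
    (hB : IsUpperSet B) (hNup : IsUpperSet N) (hAB : A \ B ⊆ N) (hBA : B \ A ⊆ N) (hN : N ⊆ A ∪ B) :
    strongCubicMax p A B N ≤ strongCubicPlus p A B N := by
  rw [strongCubicPlus_eq_defect]
  have hκ := mass_nonneg p (A ∩ B ∩ N)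
  have ho := mass_nonneg p (A ∪ B)ᶜ
  have hG := gladkovDefect_nonneg p hA hB hNup hAB hBA hN
  have hmax : max (m⟦p, A ∩ B ∩ N⟧) (m⟦p, (A ∪ B)ᶜ⟧) ≤ m⟦p, A ∩ B ∩ N⟧ + m⟦p, (A ∪ B)ᶜ⟧ :=
    max_le (by linarith) (by linarith)
  have := mul_le_mul_of_nonneg_right hmax hG
  simp only [strongCubicMax]
  linarith

/-- **One-payer dichotomy.**  When `G ≥ 0` (e.g. for up-sets), `0 ≤ F_S^max` iff **the core pays for all rainbows**
(`e₃ ≤ κ·G`) **or the outside does** (`e₃ ≤ o·G`). [this work] -/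
theorem strongCubicMax_nonneg_iff (p : ι → unitInterval) {A B N : Set (Set ι)} (hG : 0 ≤ gladkovDefect p A B N) :
    0 ≤ strongCubicMax p A B N ↔
      m⟦p, A \ B⟧ * m⟦p, B \ A⟧ * m⟦p, (A ∩ B) \ N⟧ ≤ m⟦p, A ∩ B ∩ N⟧ * gladkovDefect p A B N ∨
        m⟦p, A \ B⟧ * m⟦p, B \ A⟧ * m⟦p, (A ∩ B) \ N⟧ ≤ m⟦p, (A ∪ B)ᶜ⟧ * gladkovDefect p A B N := by
  simp only [strongCubicMax, sub_nonneg, max_mul_of_nonneg _ _ hG, le_max_iff]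

/-- The difference of the two one-sided slacks is `(o − κ)·G`: at the measure level the candidate payer is simply the
heavier of core and outside. [this work] -/
theorem outside_sub_core_slack (p : ι → unitInterval) (A B N : Set (Set ι)) :
    (m⟦p, (A ∪ B)ᶜ⟧ * gladkovDefect p A B N - m⟦p, A \ B⟧ * m⟦p, B \ A⟧ * m⟦p, (A ∩ B) \ N⟧)
      - (m⟦p, A ∩ B ∩ N⟧ * gladkovDefect p A B N - m⟦p, A \ B⟧ * m⟦p, B \ A⟧ * m⟦p, (A ∩ B) \ N⟧)
      = (m⟦p, (A ∪ B)ᶜ⟧ - m⟦p, A ∩ B ∩ N⟧) * gladkovDefect p A B N := by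
  ring

/-! ### 2. The typed conjecture S₃^max and the kernel links -/

/-- **CONJECTURE S₃^max (one-payer / max-side cubic inequality; typed).**  For every sandwiched increasing triple
`(A, B, N)` determined by a finite coordinate set: `max(κ, o)·(κo − e₂) ≥ e₃` in the five cells, i.e. `e₃ ≤ o·(κo−e₂)` or
`e₃ ≤ κ·(κo−e₂)`.  Stronger than S₃⁺ (`strongCubicPlusNonneg_of_max`); tight (equality) on the standard 3-coordinate system
for every bias vector with `o ≥ κ` and on its dual for `κ ≥ o`; exact census in the file header (0 failures, maximal ratio
`e₃ / (max(κ,o)·G) = 1` only at dressings of std3 / dual-std3). [this work] [status: open] -/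
@[conjecture] def StrongCubicMaxNonneg (p : ι → unitInterval) : Prop :=
  ∀ (S : Finset ι) (A B N : Set (Set ι)), IsUpperSet A → IsUpperSet B → IsUpperSet N →
    A \ B ⊆ N → B \ A ⊆ N → N ⊆ A ∪ B →
    DeterminedBy A (↑S : Set ι) → DeterminedBy B (↑S : Set ι) → DeterminedBy N (↑S : Set ι) →
    0 ≤ strongCubicMax p A B N

/-- **S₃^max ⟹ S₃⁺.** [this work] -/
theorem strongCubicPlusNonneg_of_max (p : ι → unitInterval) (h : StrongCubicMaxNonneg p) :
    StrongCubicPlusNonneg p :=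
  fun S A B N hA hB hN hAB hBA hNs dA dB dN =>
    le_trans (h S A B N hA hB hN hAB hBA hNs dA dB dN) (strongCubicMax_le_strongCubicPlus p hA hB hN hAB hBA hNs)

/-- **S₃^max ⟹ S₃** (`strongCubic ≥ 0` for every sandwiched increasing triple). [this work] -/
theorem strongCubic_nonneg_of_max (p : ι → unitInterval) (h : StrongCubicMaxNonneg p) {A B N : Set (Set ι)}
    (hA : IsUpperSet A) (hB : IsUpperSet B) (hN : IsUpperSet N) (hAB : A \ B ⊆ N) (hBA : B \ A ⊆ N) (hNs : N ⊆ A ∪ B) :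
    0 ≤ strongCubic p A B N :=
  strongCubic_nonneg_of_plus p (strongCubicPlusNonneg_of_max p h) hA hB hN hAB hBA hNs

/-- **S₃^max ⟹ the co-sunflower class law** (Sahi's `C₃` / Kahn's `E₃ ≥ 0` for every sandwiched increasing triple). [this work] -/
theorem classLaw_of_max (p : ι → unitInterval) (h : StrongCubicMaxNonneg p) {A B N : Set (Set ι)}
    (hA : IsUpperSet A) (hB : IsUpperSet B) (hN : IsUpperSet N) (hAB : A \ B ⊆ N) (hBA : B \ A ⊆ N) (hNs : N ⊆ A ∪ B) :
    0 ≤ sahiE (bernoulliWeight p) 3 ![ind A, ind B, ind N] :=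
  classLaw_of_plus p (strongCubicPlusNonneg_of_max p h) hA hB hN hAB hBA hNs

/-- **S₃^max ⟹ `E₃(G₂∪G₃, G₁∪G₃, G₁∪G₂) ≥ 0`** for all increasing `G_i` (the T-row / AT₃ on the class). [this work] -/
theorem coSunflower_nonneg_of_max (p : ι → unitInterval) (h : StrongCubicMaxNonneg p) {G₁ G₂ G₃ : Set (Set ι)}
    (h₁ : IsUpperSet G₁) (h₂ : IsUpperSet G₂) (h₃ : IsUpperSet G₃) :
    0 ≤ sahiE (bernoulliWeight p) 3 ![ind (G₂ ∪ G₃), ind (G₁ ∪ G₃), ind (G₁ ∪ G₂)] :=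
  coSunflower_nonneg_of_plus p (strongCubicPlusNonneg_of_max p h) h₁ h₂ h₃

/-- **The class law with the one-payer slack made explicit**: for every sandwiched triple of up-sets,
`E₃(A,B,N) = F_S^max + (1 + o − max(κ,o))·G` with both correction factors nonnegative — so `E₃ ≥ F_S^max`
unconditionally, and Kahn's inequality on the class follows from the dichotomy with room `(1 + o − max(κ,o))·G` to spare. [this work] -/
theorem sahiE_three_eq_max_add (p : ι → unitInterval) {A B N : Set (Set ι)}
    (hAB : A \ B ⊆ N) (hBA : B \ A ⊆ N) (hN : N ⊆ A ∪ B) :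
    sahiE (bernoulliWeight p) 3 ![ind A, ind B, ind N] =
      strongCubicMax p A B N
        + (1 + m⟦p, (A ∪ B)ᶜ⟧ - max (m⟦p, A ∩ B ∩ N⟧) (m⟦p, (A ∪ B)ᶜ⟧)) * gladkovDefect p A B N := by
  rw [sahiE_three_eq_cells p hAB hBA hN]
  simp only [strongCubicMax, gladkovDefect]
  ring

/-- **`E₃ ≥ F_S^max` unconditionally** for sandwiched triples of up-sets. [this work] -/
theorem strongCubicMax_le_sahiE_three (p : ι → unitInterval) {A B N : Set (Set ι)} (hA : IsUpperSet A)
    (hB : IsUpperSet B) (hNup : IsUpperSet N) (hAB : A \ B ⊆ N) (hBA : B \ A ⊆ N) (hN : N ⊆ A ∪ B) :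
    strongCubicMax p A B N ≤ sahiE (bernoulliWeight p) 3 ![ind A, ind B, ind N] := by
  rw [sahiE_three_eq_max_add p hAB hBA hN]
  have hκ := mass_nonneg p (A ∩ B ∩ N)
  have ho := mass_nonneg p (A ∪ B)ᶜ
  have hG := gladkovDefect_nonneg p hA hB hNup hAB hBA hN
  have h1 : max (m⟦p, A ∩ B ∩ N⟧) (m⟦p, (A ∪ B)ᶜ⟧) ≤ 1 + m⟦p, (A ∪ B)ᶜ⟧ := by
    refine max_le ?_ (by linarith)
    have hsum := cells_sum_eq_one p A B N
    have := mass_nonneg p (A \ B); have := mass_nonneg p (B \ A); have := mass_nonneg p ((A ∩ B) \ N)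
    linarith
  nlinarith [mul_nonneg (sub_nonneg.2 h1) hG]

end SahiDeepCore

end Summit.CriticalPhenomena.PercolationContinuityZ3.Theorems
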